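import Summits.HodgeConjecture.HodgeConjecture.Theorems.Ring2HypothesesCMPowerDivisorial
import HarnessLib

/-!
# Ring-2 hypotheses layer, part XII — the CM-POWER class is CLOSED UNDER POWERS AND PRODUCTS:
`Bᵖ = Dᵖ` and HC on EVERY POWER of every abelian variety isogenous to a power of one CM elliptic curve
(the atlas's "exc(A^•)" column at CM-power members; `HC_CM` discharged on power families)

HONEST FRAMING (page 1): research route conditional on HC_CM; not a corollary; Q11.4-sentence-2 already refuted in
dim ≥ 3. `HC_CM` = `Theses.RankFourFaces.CMAbelianHodge` (stmt-HodgeConjecture-3052), a binder BY NAME wherever it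
occurs in the cell; it does NOT occur in this file — every row below is UNCONDITIONAL. NOTHING here is a new case of
the Hodge conjecture in print: the content is van Geemen's Theorem 4.3 (Tate / Murasaki / Imai: `Bᵖ(X) = Dᵖ(X)` for
`X` isogenous to a product of elliptic curves), in the kernel scope the tree can reach — every abelian variety built
from ONE elliptic curve `E` with complex multiplication by powers, binary products and isogenous pre-images, AND ALL
POWERS OF THOSE. Parts VIII / X (`cmPowerAnchor`: a chart `A₀ ~ Eᴺ⁺¹`) stop at the variety itself; the exceptional-
Hodge-class ATLAS of the cell (LEAD §L3, column (c2) "exc(A^•)": Moonen–Zarhin's condition (D) `B•(Xⁿ) = D•(Xⁿ)` for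
all `n`) and the atlas seat's POWER cells (`∀ A, <class> → ∀ N, 0 < N → HodgeConjectureFor (A.powSucc N).dim _`)
ask about `A^{N+1}`. An isogeny `A ~ Eᴷ⁺¹` does not hand the kernel an isogeny `A^{N+1} ~ E^{(K+1)(N+1)}` (no
re-bracketing isogenies of iterated `prod` in the tree); the Literature seat's GENERATION CRITERION does not need one:

* `Gen_E(B)` := "every `(1,0)`-class of `B` is a combination of pull-backs `g^*w`, `g : B → E`, `w ∈ H^{1,0}(E)`"
  (spelled out below, never a `def`) is stable under `B ↦ B × B'` (tree `AbelianVariety.hodgeOneZero_mem_span_pullback_prod`),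
  under isogenous pre-images (part X `AbelianVariety.hodgeOneZero_mem_span_pullback_of_isIsogeny`), holds at `E`
  (`…_self`), HENCE under `B ↦ B^{M+1}` (§1, induction) — and `Gen_E(B)` gives `Bᵖ(B) = Dᵖ(B)` and HC(B) when `E` has
  complex multiplication (tree `EllipticCurve.hodgeClasses_divisorial_of_hodgeOneZero_mem_span_pullback`,
  `EllipticCurve.hodgeConjectureFor_of_hodgeOneZero_mem_span_pullback`).

| row | Lean name | status | what it says |
|---|---|---|---|
| C1 | `AbelianVariety.hodgeOneZero_mem_span_pullback_powSucc_of` | PROVED | `Gen_E(B) ⟹ Gen_E(B^{M+1})` for every `B` (not only `B = E`) |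
| C2 | `AbelianVariety.hodgeOneZero_mem_span_pullback_powSucc_of_isIsogenous_powSucc`, `…_prod_of_isIsogenous_powSucc` | PROVED | `A ~ Eᴷ⁺¹ ⟹ Gen_E(A^{M+1})`; `A ~ Eᵃ⁺¹, B ~ Eᵇ⁺¹ ⟹ Gen_E(A × B)` |
| C3 | `EllipticCurve.hodgeClasses_divisorial_powSucc_of_isIsogenous_powSucc_of_cm` | PROVED | **MZ condition (D) on the CM-power class**: `A ~ Eᴷ⁺¹`, `E` CM ⟹ `Bᵖ(A^{M+1}) = Dᵖ(A^{M+1})` (rational `(p,p)` classes ∈ `divisorClassesSpan`) for ALL `M, p` |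
| C4 | `EllipticCurve.hodgeConjectureFor_powSucc_of_isIsogenous_powSucc_of_cm`, `…_prod_of_isIsogenous_powSucc_of_cm`, `EllipticCurve.hodgeClasses_divisorial_prod_of_isIsogenous_powSucc_of_cm` | PROVED | HC and `B = D` for every power `A^{M+1}` and every product `A × B` of members of the CM-power class — UNCONDITIONAL |
| C5 | `isOfCMType_powSucc_of_isIsogenous_powSucc_of_cm`, `cmHodgeHypothesisAt_powSucc_of_isIsogenous_powSucc_of_cm` | PROVED | the powers are of CM type and `HC_CM` HOLDS AT THEM as a theorem (Milne's hypothesis (H) at `A^{M+1}`) |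
| C6 | `mem_anchorLocus_of_chart_powSucc_of_isIsogenous_powSucc_of_cm`, `mem_cmLocus_of_chart_powSucc_…`, `divisorGeneratedCMAnchor_of_chart_powSucc_…`, `cmAnchor_of_chart_powSucc_…`, `mem_algebraicClasses_of_chart_powSucc_…`, `hodgeConjectureFor_fiber_of_invariantCycles_of_powSucc_chart_of_extend` | PROVED | hypotheses layer: a fibre of ANY family (in particular a fibre-power family `𝒳 ×_S ⋯ ×_S 𝒳`) charted by `A^{M+1}`, `A ~ Eᴷ⁺¹`, lies in `anchorLocus ∩ cmLocus` WITHOUT `HC_CM`, and is a divisor-generated CM anchor of part VII-A — so parts V/VI (D3/D8 engines) and VII-A/XI (W1′ / W1′-loc rows) apply to POWER families pointed at such fibres with `HC_CM` DISCHARGED |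

ATLAS SERVICE (LEAD §L3.5 (c6)/(c7), atlas seat 1's staged `Ring2AtlasOpenCells.lean`): for each POWER cell
(`HodgePowersOfWeilTypeFourfold`, `HodgePowersOfMumfordTypeFourfold`, `HodgePowersOfTypeIIIFourfold`,
`HodgePowersOfEllipticTimesFourfold13` — shape `∀ A, 𝒞 A → ∀ N, 0 < N → HodgeConjectureFor (A.powSucc N).dim (A.powSucc N).X`)
the (c6) missing input is part V's `InvariantCyclesHoldFor` / `HodgeClassesExtendAt` ON THE FIBRE-POWER FAMILY through
`A^{N+1}` (per-variety engine D3 `hodgeConjectureFor_of_HC_CM_of_invariantCycles_on_families_through` at `A.powSucc N`,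
verbatim), and (c7) the KIND of `HC_CM` is DISCHARGED on the sub-cell `{A ~ E_K-power}` by C4 (the Weil-type cell
contains such members on every component with an `E_K`-power member, parts VIII/IX; the Mumford-type and type-III
cells contain none — their CM members are simple or not `E`-isogenous — so there `HC_CM` stays LOAD-BEARING per D3).

HONEST COLUMN. (i) Print scope of vG 4.3 is "isogenous to a product of elliptic curves" (ANY curves, Imai 1976 for
pairwise non-isogenous factors); kernel scope after this file = the closure of `{E}` (`E` ONE CM curve) under `prod`,
`powSucc`, isogenous pre-images, in any order — mixed products `∏ Eᵢ^{nᵢ}` of non-isogenous CM curves are still NOT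
covered (needs `Hg(∏ Eᵢ) = ∏ Hg(Eᵢ)` on the carriers; Literature seat). (ii) No new open input is typed here and none
is discharged beyond the anchor: the transport input of a power cell (fibre-power (1.1) / W-VHC) is exactly as open as
for `N = 0`. (iii) Mathematically `Gen_E(B)` ⟺ "`B` is isogenous to a power of `E`" (Poincaré reducibility); only
"⟸" is in the tree (part X P1 + tree `…_powSucc`), which is the direction used.

References: [vanGeemen1994HodgeAV] B. van Geemen, *An introduction to the Hodge conjecture for abelian varieties*,
LNM 1594 (1994), Lemma 3.7, Thm. 4.3, 5.5, 5.12; [Gordon1997] B. Gordon, *A survey of the Hodge conjecture for abelian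
varieties* (appendix to Lewis), §3 (Tate, Murasaki, Imai); [MoonenZarhin1999LowDim] Math. Ann. 315 (1999), (1.8)
condition (D); [Milne1999] J. Milne, *Lefschetz motives and the Tate conjecture*, Compositio 117 (1999), §2 p. 54, §7
p. 72; [Abdulali1994FamiliesAV] S. Abdulali, Can. J. Math. 46 (1994), (1.1), Lemma 6.2.
-/

noncomputable section

set_option linter.dupNamespace false

open CategoryTheory
open Literature.AlgebraicGeometry Literature.AlgebraicGeometry.Motives
open Literature.AlgebraicGeometry.HodgeTheory
open Literature.AlgebraicTopology.SingularHomology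
open Literature.AlgebraicGeometry.Milne1999 (IsOfCMType CMHodgeHypothesisAt)
open Literature.AlgebraicGeometry.VanGeemen1994
open Literature.Barriers.HodgeConjecture (divisorClassesSpan)
open Summit.HodgeConjecture.HodgeConjecture.WeilTypeLadder
open Summit.HodgeConjecture.HodgeConjecture.Theses
open Summit.HodgeConjecture.HodgeConjecture.Ring2Transport
open Summit.HodgeConjecture.HodgeConjecture.Ring2.Deform (cmLocus)

namespace Summit.HodgeConjecture.HodgeConjecture.Ring2.Hypotheses

/-! ## §1 The generation criterion is stable under powers (and products, isogenous pre-images: tree / part X) -/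

/-- **C1 — `Gen_E(B) ⟹ Gen_E(B^{M+1})`**: if the `(1,0)`-classes of `B` are combinations of pull-backs of
`(1,0)`-classes of `E`, so are those of every power `B.powSucc M` (`B^{M+2} = B^{M+1} × B` definitionally; Künneth in
degree one, tree `AbelianVariety.hodgeOneZero_mem_span_pullback_prod`). The tree's `…_powSucc` is the case `B = E`.
[cite: Gordon1997, §3 (proof of the Theorem: `H¹(Xⁿ) = H¹(X) ⊕ ⋯ ⊕ H¹(X)`)] [cite: LangeBirkenhake1992, Thm. 4.2.1] -/
theorem AbelianVariety.hodgeOneZero_mem_span_pullback_powSucc_of (E B : AbelianVariety ℂ)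
    (hB : ∀ u : complexBetti B.X 1, IsOfHodgeType B.dim B.X 1 1 0 u →
      u ∈ Submodule.span ℂ {y : complexBetti B.X 1 | ∃ (g : B ⟶ E) (w : complexBetti E.X 1),
        IsOfHodgeType E.dim E.X 1 1 0 w ∧ y = complexBetti.map g.hom.hom.hom 1 w}) :
    ∀ (M : ℕ) (u : complexBetti (B.powSucc M).X 1), IsOfHodgeType (B.powSucc M).dim (B.powSucc M).X 1 1 0 u →
      u ∈ Submodule.span ℂ {y : complexBetti (B.powSucc M).X 1 | ∃ (g : B.powSucc M ⟶ E) (w : complexBetti E.X 1),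
        IsOfHodgeType E.dim E.X 1 1 0 w ∧ y = complexBetti.map g.hom.hom.hom 1 w}
  | 0 => hB
  | M + 1 => AbelianVariety.hodgeOneZero_mem_span_pullback_prod E (B.powSucc M) B
      (AbelianVariety.hodgeOneZero_mem_span_pullback_powSucc_of E B hB M) hB

/-- **C2 — powers of an isogenous pre-image of `Eᴷ⁺¹` satisfy the generation criterion**: `A ~ Eᴷ⁺¹ ⟹
Gen_E(A^{M+1})` (tree `…_powSucc` at `Eᴷ⁺¹`, part X P1 along the isogeny, C1). No complex multiplication needed.
[cite: vanGeemen1994HodgeAV, Lemma 3.7] [cite: Gordon1997, §3] -/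
theorem AbelianVariety.hodgeOneZero_mem_span_pullback_powSucc_of_isIsogenous_powSucc (E : AbelianVariety ℂ)
    (K : ℕ) {A : AbelianVariety ℂ} (hA : A.IsIsogenous (E.powSucc K)) (M : ℕ)
    (u : complexBetti (A.powSucc M).X 1) (hu : IsOfHodgeType (A.powSucc M).dim (A.powSucc M).X 1 1 0 u) :
    u ∈ Submodule.span ℂ {y : complexBetti (A.powSucc M).X 1 | ∃ (g : A.powSucc M ⟶ E) (w : complexBetti E.X 1),
        IsOfHodgeType E.dim E.X 1 1 0 w ∧ y = complexBetti.map g.hom.hom.hom 1 w} := by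
  obtain ⟨f, hf⟩ := hA
  exact AbelianVariety.hodgeOneZero_mem_span_pullback_powSucc_of E A
    (AbelianVariety.hodgeOneZero_mem_span_pullback_of_isIsogeny E f hf
      (AbelianVariety.hodgeOneZero_mem_span_pullback_powSucc E K)) M u hu

/-- **C2 (products) — `A ~ Eᵃ⁺¹`, `B ~ Eᵇ⁺¹ ⟹ Gen_E(A × B)`** (part X P1 twice, tree `…_prod`).
[cite: vanGeemen1994HodgeAV, Lemma 3.7 and §5.3] [cite: Gordon1997, §3] -/
theorem AbelianVariety.hodgeOneZero_mem_span_pullback_prod_of_isIsogenous_powSucc (E : AbelianVariety ℂ)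
    {a b : ℕ} {A B : AbelianVariety ℂ} (hA : A.IsIsogenous (E.powSucc a)) (hB : B.IsIsogenous (E.powSucc b))
    (u : complexBetti (A.prod B).X 1) (hu : IsOfHodgeType (A.prod B).dim (A.prod B).X 1 1 0 u) :
    u ∈ Submodule.span ℂ {y : complexBetti (A.prod B).X 1 | ∃ (g : A.prod B ⟶ E) (w : complexBetti E.X 1),
        IsOfHodgeType E.dim E.X 1 1 0 w ∧ y = complexBetti.map g.hom.hom.hom 1 w} := by
  obtain ⟨f, hf⟩ := hA
  obtain ⟨g, hg⟩ := hB
  exact AbelianVariety.hodgeOneZero_mem_span_pullback_prod E A B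
    (AbelianVariety.hodgeOneZero_mem_span_pullback_of_isIsogeny E f hf
      (AbelianVariety.hodgeOneZero_mem_span_pullback_powSucc E a))
    (AbelianVariety.hodgeOneZero_mem_span_pullback_of_isIsogeny E g hg
      (AbelianVariety.hodgeOneZero_mem_span_pullback_powSucc E b)) u hu

/-! ## §2 `Bᵖ = Dᵖ` and HC on every power / product of members of the CM-power class (UNCONDITIONAL) -/

section CM

variable {E : AbelianVariety ℂ} (hE : E.dim = 1) (φ : E ⟶ E) {d : ℕ} (hd : 0 < d) (hφ : φ ≫ φ = -(d • 𝟙 E))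
include hE hd hφ

/-- **C3 — Moonen–Zarhin's condition (D) for the CM-power class: `Bᵖ(A^{M+1}) = Dᵖ(A^{M+1})` for ALL `M` and
`p`** whenever `A` is isogenous to a power `Eᴷ⁺¹` of an elliptic curve with complex multiplication (`φ² = -d`,
`d ≥ 1`): every rational `(p,p)` class of `A^{M+1}` is a polynomial in divisor classes. C2 + the Literature seat's
`EllipticCurve.hodgeClasses_divisorial_of_hodgeOneZero_mem_span_pullback`. UNCONDITIONAL; van Geemen 4.3 in its
printed strength, kernel scope. [cite: vanGeemen1994HodgeAV, Lemma 3.7 and Thm. 4.3]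
[cite: MoonenZarhin1999LowDim, (1.8) condition (D)] [cite: Gordon1997, §3 (Murasaki)] -/
theorem EllipticCurve.hodgeClasses_divisorial_powSucc_of_isIsogenous_powSucc_of_cm (K : ℕ) {A : AbelianVariety ℂ}
    (hA : A.IsIsogenous (E.powSucc K)) (M p : ℕ) (c : complexBetti (A.powSucc M).X (2 * p))
    (hc : IsRationalClass c) (hpp : IsOfHodgeType (A.powSucc M).dim (A.powSucc M).X (2 * p) p p c) :
    c ∈ divisorClassesSpan (A.powSucc M).X (A.powSucc M).dim p :=
  EllipticCurve.hodgeClasses_divisorial_of_hodgeOneZero_mem_span_pullback hE φ hd hφ (A.powSucc M)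
    (AbelianVariety.hodgeOneZero_mem_span_pullback_powSucc_of_isIsogenous_powSucc E K hA M) p c hc hpp

/-- **C4 — the Hodge conjecture for EVERY POWER `A^{M+1}` of an abelian variety isogenous to a power of a CM elliptic
curve**, UNCONDITIONAL (the `N ≥ 1` instances of the atlas's power cells at their CM-power members; for `M = 0` this
is part VIII's / the tree's `EllipticCurve.hodgeConjectureFor_of_isIsogenous_powSucc_of_cm`).
[cite: vanGeemen1994HodgeAV, Lemma 3.7 and Thm. 4.3] [cite: Gordon1997, §3] -/
theorem EllipticCurve.hodgeConjectureFor_powSucc_of_isIsogenous_powSucc_of_cm (K : ℕ) {A : AbelianVariety ℂ}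
    (hA : A.IsIsogenous (E.powSucc K)) (M : ℕ) :
    HodgeConjectureFor (A.powSucc M).dim (A.powSucc M).X :=
  EllipticCurve.hodgeConjectureFor_of_hodgeOneZero_mem_span_pullback hE φ hd hφ (A.powSucc M)
    (AbelianVariety.hodgeOneZero_mem_span_pullback_powSucc_of_isIsogenous_powSucc E K hA M)

/-- **C4 (products) — the Hodge conjecture for `A × B`, `A ~ Eᵃ⁺¹`, `B ~ Eᵇ⁺¹`**, `E` a CM elliptic curve (e.g.
`X × X` for a CM-power member `X` of a Weil component — the atlas's `X²` rows), UNCONDITIONAL.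
[cite: vanGeemen1994HodgeAV, Lemma 3.7, Thm. 4.3 and §5.3] -/
theorem EllipticCurve.hodgeConjectureFor_prod_of_isIsogenous_powSucc_of_cm {a b : ℕ} {A B : AbelianVariety ℂ}
    (hA : A.IsIsogenous (E.powSucc a)) (hB : B.IsIsogenous (E.powSucc b)) :
    HodgeConjectureFor (A.prod B).dim (A.prod B).X :=
  EllipticCurve.hodgeConjectureFor_of_hodgeOneZero_mem_span_pullback hE φ hd hφ (A.prod B)
    (AbelianVariety.hodgeOneZero_mem_span_pullback_prod_of_isIsogenous_powSucc E hA hB)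

/-- **C4 (products, printed strength) — `Bᵖ(A × B) = Dᵖ(A × B)`** for `A ~ Eᵃ⁺¹`, `B ~ Eᵇ⁺¹`, `E` CM.
[cite: vanGeemen1994HodgeAV, Thm. 4.3 and §5.3] [cite: MoonenZarhin1999LowDim, (1.8) condition (D)] -/
theorem EllipticCurve.hodgeClasses_divisorial_prod_of_isIsogenous_powSucc_of_cm {a b : ℕ} {A B : AbelianVariety ℂ}
    (hA : A.IsIsogenous (E.powSucc a)) (hB : B.IsIsogenous (E.powSucc b)) (p : ℕ)
    (c : complexBetti (A.prod B).X (2 * p)) (hc : IsRationalClass c)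
    (hpp : IsOfHodgeType (A.prod B).dim (A.prod B).X (2 * p) p p c) :
    c ∈ divisorClassesSpan (A.prod B).X (A.prod B).dim p :=
  EllipticCurve.hodgeClasses_divisorial_of_hodgeOneZero_mem_span_pullback hE φ hd hφ (A.prod B)
    (AbelianVariety.hodgeOneZero_mem_span_pullback_prod_of_isIsogenous_powSucc E hA hB) p c hc hpp

/-- **C5 — the powers are of CM type** (part VIII `isOfCMType_of_isIsogenous_powSucc_of_cm` + `isOfCMType_powSucc`).
[cite: Milne1999, §2 p. 54] -/
theorem isOfCMType_powSucc_of_isIsogenous_powSucc_of_cm (K : ℕ) {A : AbelianVariety ℂ}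
    (hA : A.IsIsogenous (E.powSucc K)) (M : ℕ) : IsOfCMType (A.powSucc M) :=
  isOfCMType_powSucc (isOfCMType_of_isIsogenous_powSucc_of_cm hE φ hd hφ K hA) M

/-- **C5 — `HC_CM` HOLDS, as a theorem, at every power of a member of the CM-power class** (Milne's hypothesis (H)
of Thm. 7.1 at `A^{M+1}`; part VIII `cmHodgeHypothesisAt_of_isIsogenous_powSucc_of_cm` is `M = 0`).
[cite: Milne1999, §7 p. 72] [cite: vanGeemen1994HodgeAV, Thm. 4.3] -/
theorem cmHodgeHypothesisAt_powSucc_of_isIsogenous_powSucc_of_cm (K : ℕ) {A : AbelianVariety ℂ}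
    (hA : A.IsIsogenous (E.powSucc K)) (M : ℕ) : CMHodgeHypothesisAt (A.powSucc M) :=
  fun _ _ ↦ EllipticCurve.hodgeConjectureFor_powSucc_of_isIsogenous_powSucc_of_cm hE φ hd hφ K hA M

/-! ## §3 Hypotheses layer: power fibres of the CM-power class are anchors, CM points and divisor-generated CM
anchors — WITHOUT `HC_CM` -/

variable {𝒳 S : SchemeOver ℂ}

/-- **C6 — a fibre charted by `A^{M+1}`, `A ~ Eᴷ⁺¹`, `E` CM, lies in the ANCHOR LOCUS of its family** (part V's
`anchorLocus`; any family — in the atlas's use, the `(M+1)`-th fibre power `𝒳 ×_S ⋯ ×_S 𝒳 → S` of a Weil / Mumford–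
Tate family pointed at a CM-power member), with NO `HC_CM` (compare part V `cmLocus_subset_anchorLocus_of_HC_CM`).
[cite: vanGeemen1994HodgeAV, Lemma 3.7 and Thm. 4.3] [cite: Abdulali1994FamiliesAV, proof of Lemma 6.2 (p. 1131)] -/
theorem mem_anchorLocus_of_chart_powSucc_of_isIsogenous_powSucc_of_cm {f : 𝒳 ⟶ S} {n : ℕ} {s : ComplexPoints S}
    (K : ℕ) {A : AbelianVariety ℂ} (hA : A.IsIsogenous (E.powSucc K)) (M : ℕ)
    (e₀ : (A.powSucc M).X ≅ fiberOver f s) (hn : (A.powSucc M).dim = n) : s ∈ anchorLocus f n :=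
  mem_anchorLocus_of_chart e₀
    (hn ▸ EllipticCurve.hodgeConjectureFor_powSucc_of_isIsogenous_powSucc_of_cm hE φ hd hφ K hA M)

/-- **C6 — such a fibre is a CM point of the family** (`Ring2.Deform.cmLocus`). [cite: Milne1999, §2 p. 54]
[cite: Mumford1969NoteShimura, §3] -/
theorem mem_cmLocus_of_chart_powSucc_of_isIsogenous_powSucc_of_cm {f : 𝒳 ⟶ S} {n : ℕ} {s : ComplexPoints S}
    (K : ℕ) {A : AbelianVariety ℂ} (hA : A.IsIsogenous (E.powSucc K)) (M : ℕ)
    (e₀ : (A.powSucc M).X ≅ fiberOver f s) (hn : (A.powSucc M).dim = n) : s ∈ cmLocus f n :=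
  ⟨A.powSucc M, ⟨e₀⟩, hn, isOfCMType_powSucc_of_isIsogenous_powSucc_of_cm hE φ hd hφ K hA M⟩

/-- **C6 — a chart by `A^{M+1}` (`A ~ Eᴷ⁺¹`, `E` CM, `dim A^{M+1} = 2n`) is a DIVISOR-GENERATED CM ANCHOR of part
VII-A** (`divisorGeneratedCMAnchor n`: CM chart with `Hdg = Div`), so every `…_of_divisorGeneratedCMPointed[_local]`
row of parts VII-A / XI-A and of the gen-3 transport layer applies to `(ℚ(√-d), 2n, δ)`-families pointed at a POWER of
a CM-power member (e.g. `X × X`, `X ~ E_K^4` a Weil-type fourfold, on an eightfold component), `HC_CM`-free; part X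
P2 is the case `M = 0`. [cite: vanGeemen1994HodgeAV, Thm. 4.3 and 5.5] [cite: Deligne1982HodgeCycles, §5] -/
theorem divisorGeneratedCMAnchor_of_chart_powSucc_of_isIsogenous_powSucc_of_cm {n : ℕ} {X : SchemeOver ℂ}
    {x : complexBetti X (2 * n)} (K : ℕ) {A : AbelianVariety ℂ} (hA : A.IsIsogenous (E.powSucc K)) (M : ℕ)
    (e₀ : (A.powSucc M).X ≅ X) (hdim : (A.powSucc M).dim = 2 * n) : divisorGeneratedCMAnchor n X x :=
  ⟨A.powSucc M, ⟨e₀⟩, hdim, isOfCMType_powSucc_of_isIsogenous_powSucc_of_cm hE φ hd hφ K hA M,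
    fun y hyQ hyH ↦
      EllipticCurve.hodgeClasses_divisorial_powSucc_of_isIsogenous_powSucc_of_cm hE φ hd hφ K hA M n y hyQ hyH⟩

/-- **C6 — … and hence a CM anchor** (part VII-A `cmAnchor n`; with `HC_CM` NOT needed for its validity, which is
`divisorGeneratedCMAnchor_valid`). [cite: Milne1999, §2 p. 54] -/
theorem cmAnchor_of_chart_powSucc_of_isIsogenous_powSucc_of_cm {n : ℕ} {X : SchemeOver ℂ}
    {x : complexBetti X (2 * n)} (K : ℕ) {A : AbelianVariety ℂ} (hA : A.IsIsogenous (E.powSucc K)) (M : ℕ)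
    (e₀ : (A.powSucc M).X ≅ X) (hdim : (A.powSucc M).dim = 2 * n) : cmAnchor n X x :=
  ⟨A.powSucc M, ⟨e₀⟩, hdim, isOfCMType_powSucc_of_isIsogenous_powSucc_of_cm hE φ hd hφ K hA M⟩

/-- **C6 — validity at power charts, spelled out**: a rational `(n,n)` class on a `2n`-fold charted by `A^{M+1}`,
`A ~ Eᴷ⁺¹`, `E` CM, is ALGEBRAIC — no `HC_CM` (`divisorGeneratedCMAnchor_valid` ∘ the previous row).
[cite: vanGeemen1994HodgeAV, 2.4, Lemma 3.7 and Thm. 4.3] -/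
theorem mem_algebraicClasses_of_chart_powSucc_of_isIsogenous_powSucc_of_cm {n : ℕ} {X : SchemeOver ℂ}
    (x : complexBetti X (2 * n)) (K : ℕ) {A : AbelianVariety ℂ} (hA : A.IsIsogenous (E.powSucc K)) (M : ℕ)
    (e₀ : (A.powSucc M).X ≅ X) (hdim : (A.powSucc M).dim = 2 * n) (hxQ : IsRationalClass x)
    (hxH : IsOfHodgeType (2 * n) X (2 * n) n n x) : x ∈ algebraicClasses X n :=
  divisorGeneratedCMAnchor_valid n X x
    (divisorGeneratedCMAnchor_of_chart_powSucc_of_isIsogenous_powSucc_of_cm hE φ hd hφ K hA M e₀ hdim) hxQ hxH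

/-- **Row D8 for POWER families — `HC(A^{M+1})`-type fibres as anchors in part VI's general-fibre engine, WITHOUT
`HC_CM`**: on a smooth projective family of relative dimension `n` satisfying Grothendieck's (1.1) and having a fibre
charted by a power `A^{M+1}` of a member of the CM-power class, the Hodge conjecture holds at every Hodge-generic fibre
(part V `hodgeConjectureFor_fiber_of_invariantCycles_of_anchor_of_extend`; the OPEN content is (1.1) on the family —
for the atlas's power cells, (1.1) on the fibre-power family). [cite: Abdulali1994FamiliesAV, (1.1) and Lemma 6.2]
[cite: vanGeemen1994HodgeAV, Thm. 4.3] -/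
theorem hodgeConjectureFor_fiber_of_invariantCycles_of_powSucc_chart_of_extend {f : 𝒳 ⟶ S} {n : ℕ}
    (hf : IsSmoothProjectiveFamily f n) (hIC : Abdulali1994.InvariantCyclesHoldFor f n)
    {s₀ : ComplexPoints S} (K : ℕ) {A : AbelianVariety ℂ} (hA : A.IsIsogenous (E.powSucc K)) (M : ℕ)
    (e₀ : (A.powSucc M).X ≅ fiberOver f s₀) (hn : (A.powSucc M).dim = n)
    {s : ComplexPoints S} (hs : HodgeClassesExtendAt f n s) : HodgeConjectureFor n (fiberOver f s) :=
  hodgeConjectureFor_fiber_of_invariantCycles_of_anchor_of_extend hf hIC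
    ⟨s₀, mem_anchorLocus_of_chart_powSucc_of_isIsogenous_powSucc_of_cm hE φ hd hφ K hA M e₀ hn⟩ hs

end CM

end Summit.HodgeConjecture.HodgeConjecture.Ring2.Hypotheses

end
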